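import Mathlib
import Summits.Ventures.PercRepro2.SwOutCrossGenKEThm

/-!
# The fibre data with EDGE atoms (blind cell PercRepro2, night-4 g23, 2026-08-28;
proofs/NIGHT4-G23.md §10, step (2))

For the transfer to the geometry the red atoms must be the EDGE CLASSES of the red cluster of `u`:
the u–`p i` edges with a red u-edge bit and the red cross edges at an attached end — not the
attached vertices (an attached vertex may carry a blue u-edge).  `redKEE` is that atom map on the
same fibre `FibKE V G`, with the same leak, core, labels, slab injection and core pairs; the two
axioms that mention the atoms (`psi_ok`, `pair_red`) hold for it too, so **`fibKEE`** is a
`FibreData` and **`card_le_crossKEE`** is the abstract theorem with edge atoms.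
-/

namespace Summit.Ventures.PercRepro2

namespace CrossArm

open Classical

variable {V : Type*}

section EdgeAtoms

variable (G : SimpleGraph V)

/-- The edge atoms: the u–`p i` edges and the cross edges. -/
abbrev AtomKEE (V : Type*) (G : SimpleGraph V) := V ⊕ G.edgeSet

/-- The red edge atoms: a u–`p i` edge with a red u-edge bit, a red cross edge at an attached
end. -/
noncomputable def redKEE (w : FibKE V G) : AtomKEE V G → Bool
  | Sum.inl i => w.1 i
  | Sum.inr s => decide (w.2.1 s = true ∧ ∃ i ∈ s.1, attE G w i)

/-- The slab injection carries the red edge atoms. -/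
lemma psiKE_red_edge (w : FibKE V G) (a : AtomKEE V G) (ha : redKEE G w a = true) :
    redKEE G (psiKE G w).flip a = true := by
  by_cases hex : (∀ i, w.1 i = false) ∧ ∀ i, w.2.2 i = true
  · exfalso
    have hnoatt : ∀ i, ¬ attE G w i := not_attE_of_uP_false G hex.1
    cases a with
    | inl i =>
      have : w.1 i = true := ha
      rw [hex.1 i] at this
      exact Bool.noConfusion this
    | inr s =>
      simp only [redKEE, decide_eq_true_eq] at ha
      obtain ⟨-, i, -, hi⟩ := ha
      exact hnoatt i hi
  · have hflip := flip_psiKE_generic G hex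
    cases a with
    | inl i =>
      have : w.1 i = true := ha
      show (psiKE G w).flip.1 i = true
      rw [hflip]
      exact this
    | inr s =>
      simp only [redKEE, decide_eq_true_eq] at ha ⊢
      obtain ⟨hcs, i, hi, hatt⟩ := ha
      refine ⟨?_, i, hi, (attE_flip_psiKE G hex i).2 hatt⟩
      rw [hflip]
      exact hcs

/-- A lower core point has no red edge atom. -/
lemma pair_red_edge [Fintype V] [DecidableEq V] [DecidableRel G.Adj] (w : FibKE V G)
    (hw : w ∈ core0KE) (a : AtomKEE V G) (ha : redKEE G w a = true) : redKEE G w.flip a = true := by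
  exfalso
  obtain ⟨h1, -⟩ := (mem_core0KE G).1 hw
  cases a with
  | inl i =>
    have : w.1 i = true := ha
    rw [h1 i] at this
    exact Bool.noConfusion this
  | inr s =>
    simp only [redKEE, decide_eq_true_eq] at ha
    obtain ⟨-, i, -, hi⟩ := ha
    exact not_attE_of_uP_false G h1 i hi

/-- **The fibre data with edge atoms.** -/
noncomputable def fibKEE [Fintype V] [DecidableEq V] [DecidableRel G.Adj] [Nonempty V]
    (hG : G.Connected) : FibreData (FibKE V G) (AtomKEE V G) (LabelKE V) where
  flip := FibKE.flip
  flip_flip := FibKE.flip_flip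
  red := redKEE G
  leakR := leakKE G
  core := coreKE
  label := labelKE G
  BetterL := BetterKE
  betterL_refl := BetterKE_refl
  psi := psiKE G
  core_of_noLeak := coreKE_of_noLeak G hG
  leakR_core := leakKE_core G
  leakR_flip_core := leakKE_flip_core G
  core_flip := coreKE_flip
  psi_ok := fun w hr hc => by
    obtain ⟨h1, h2, h3, -⟩ := psiKE_ok G w hr hc
    exact ⟨h1, h2, h3, psiKE_red_edge G w⟩
  psi_inj := psiKE_inj G
  core0 := core0KE
  core0_core := core0KE_core G
  core_cases := coreKE_cases G
  flip_core0 := flip_core0KE G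
  pair_label := pair_labelKE G
  pair_red := pair_red_edge G

open scoped Classical in
/-- **The abstract theorem of boundary (iv) with edge atoms**, for every connected pure dropped
component. -/
theorem card_le_crossKEE [Fintype V] [DecidableEq V] [DecidableRel G.Adj] [Nonempty V]
    (hG : G.Connected) {ι : Type*} [Fintype ι] [DecidableEq ι] [Nonempty ι]
    {𝒯 : Set (TypG (LabelKE V) ι)} (h𝒯 : IsUpG (fibKEE G hG) 𝒯)
    {𝓔 : Set (Set (AtomG (AtomKEE V G) ι))} (h𝓔 : IsUpperSet 𝓔) :
    ((QG (fibKEE G hG) 𝒯).filter fun q => ERG (fibKEE G hG) q ∈ 𝓔).card ≤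
      ((QG (fibKEE G hG) 𝒯).filter fun q => EBG (fibKEE G hG) q ∈ 𝓔).card :=
  card_le_crossGen h𝒯 h𝓔

end EdgeAtoms

end CrossArm

end Summit.Ventures.PercRepro2
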